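import Literature.NumberTheory.Automorphic.BrandtMatrixClassFunction
import Literature.NumberTheory.Automorphic.BrandtWeightClassFunction
import HarnessLib

/-!
# Brandt data are invariant under ring isomorphisms

Topic `NumberTheory/Automorphic`; theorems only (no definition, no named fact, no instance).
A ring isomorphism `e : D ≃+* D'` transports `ℤ`-lattices `I ↦ e(I)`
(`Submodule.map` along the `ℤ`-linear equivalence `e.toAddEquiv.toIntLinearEquiv`), preserving
inclusions, indices, products, left/right orders, unit groups, invertibility and the action of
units (`e(α I) = e(α) e(I)`). Consequently, for every `ℤ`-submodule `O ⊆ D`, in the vocabulary of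
`BrandtXi.lean` (Voight ch. 16, 17, 41):

* `Brandt.map_ringEquiv_mem_rightIdeals` — `I ∈ rightIdeals O → e(I) ∈ rightIdeals e(O)`;
* `Brandt.IsOrder.map_ringEquiv`, `Brandt.IsMaximalOrder.map_ringEquiv`,
  `Brandt.IsEichlerOrder.map_ringEquiv` — orders, maximal orders and Eichler orders of level `N`
  are carried to the same;
* `Brandt.exists_classSetEquiv_map_ringEquiv` — a bijection `ε : Cls O ≃ Cls e(O)`,
  `ε [I] = [e(I)]`, with `weight e(O) (ε c) = weight O c` and
  `matrix e(O) n (ε c) (ε d) = matrix O n c d`;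
* `Brandt.xiOfOrder_map_ringEquiv` — **`xiOfOrder e(O) N λ = xiOfOrder O N λ`**, and for Brandt
  setups `Brandt.XiSetup.xi_eq_of_ringEquiv`: two setups of type `(N⁺, N⁻)` whose Eichler orders
  correspond under a ring isomorphism of their algebras have the same `ξ`.

Together with `BrandtXiGenus.lean` (`ξ` is constant on a genus) this reduces the independence of
Pollack–Weston's `ξ(N⁺, N⁻)` of all choices to the classical facts that the definite quaternion
algebra of discriminant `N⁻` is unique up to isomorphism and that Eichler orders of the same level
are locally conjugate (Vignéras III §5). Valid for all rings `D`, `D'`; no arithmetic input.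

## References

* J. Voight, *Quaternion Algebras*, GTM 288 (2021), §17.3, §41.1 [Voight2021].
* M.-F. Vignéras, *Arithmétique des algèbres de quaternions*, LNM 800 (1980), Ch. III §5
  [VignerasLNM800].
* R. Pollack, T. Weston, Compos. Math. 147 (2011), §2.1 [PollackWeston2011].
-/

noncomputable section

open scoped Pointwise

universe u v

namespace Literature.NumberTheory.Automorphic

variable {D : Type u} {D' : Type v} [Ring D] [Ring D']

/-! ### The lattice `e(I)` of a ring isomorphism `e` -/

/-- `x ∈ e(I) ↔ e⁻¹ x ∈ I`. [folklore] -/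
theorem mem_map_ringEquiv_iff (e : D ≃+* D') {I : Submodule ℤ D} {x : D'} :
    x ∈ I.map (e.toAddEquiv.toIntLinearEquiv : D →ₗ[ℤ] D') ↔ e.symm x ∈ I :=
  Submodule.mem_map_equiv (p := I)

/-- `e x ∈ e(I) ↔ x ∈ I`. [folklore] -/
theorem apply_mem_map_ringEquiv_iff (e : D ≃+* D') {I : Submodule ℤ D} {x : D} :
    e x ∈ I.map (e.toAddEquiv.toIntLinearEquiv : D →ₗ[ℤ] D') ↔ x ∈ I := by
  rw [mem_map_ringEquiv_iff, RingEquiv.symm_apply_apply]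

/-- `e⁻¹(e(I)) = I`. [folklore] -/
theorem map_ringEquiv_symm_map (e : D ≃+* D') (I : Submodule ℤ D) :
    (I.map (e.toAddEquiv.toIntLinearEquiv : D →ₗ[ℤ] D')).map
        (e.symm.toAddEquiv.toIntLinearEquiv : D' →ₗ[ℤ] D) = I := by
  ext x
  rw [mem_map_ringEquiv_iff, mem_map_ringEquiv_iff, RingEquiv.symm_symm, RingEquiv.symm_apply_apply]

/-- `e(e⁻¹(I')) = I'`. [folklore] -/
theorem map_map_ringEquiv_symm (e : D ≃+* D') (I' : Submodule ℤ D') :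
    (I'.map (e.symm.toAddEquiv.toIntLinearEquiv : D' →ₗ[ℤ] D)).map
        (e.toAddEquiv.toIntLinearEquiv : D →ₗ[ℤ] D') = I' := by
  ext x
  rw [mem_map_ringEquiv_iff, mem_map_ringEquiv_iff, RingEquiv.symm_symm, RingEquiv.apply_symm_apply]

/-- `I ↦ e(I)` is injective. [folklore] -/
theorem map_ringEquiv_injective (e : D ≃+* D') :
    Function.Injective (Submodule.map (e.toAddEquiv.toIntLinearEquiv : D →ₗ[ℤ] D')) :=
  fun I J h => by rw [← map_ringEquiv_symm_map e I, h, map_ringEquiv_symm_map]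

/-- `e(I) ≤ e(J) ↔ I ≤ J`. [folklore] -/
theorem map_ringEquiv_le_iff (e : D ≃+* D') {I J : Submodule ℤ D} :
    I.map (e.toAddEquiv.toIntLinearEquiv : D →ₗ[ℤ] D') ≤
        J.map (e.toAddEquiv.toIntLinearEquiv : D →ₗ[ℤ] D') ↔ I ≤ J := by
  constructor
  · intro h x hx
    have := h ((apply_mem_map_ringEquiv_iff e).2 hx)
    rwa [apply_mem_map_ringEquiv_iff] at this
  · exact fun h => Submodule.map_mono h

/-- `e(I J) = e(I) e(J)`. [folklore] -/
theorem map_ringEquiv_mul (e : D ≃+* D') (I J : Submodule ℤ D) :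
    (I * J).map (e.toAddEquiv.toIntLinearEquiv : D →ₗ[ℤ] D') =
      I.map (e.toAddEquiv.toIntLinearEquiv : D →ₗ[ℤ] D') *
        J.map (e.toAddEquiv.toIntLinearEquiv : D →ₗ[ℤ] D') := by
  apply le_antisymm
  · rw [Submodule.map_le_iff_le_comap, Submodule.mul_le]
    intro m hm n hn
    rw [Submodule.mem_comap]
    change e (m * n) ∈ _
    rw [map_mul]
    exact Submodule.mul_mem_mul ((apply_mem_map_ringEquiv_iff e).2 hm)
      ((apply_mem_map_ringEquiv_iff e).2 hn)
  · rw [Submodule.mul_le]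
    intro x hx y hy
    rw [mem_map_ringEquiv_iff] at hx hy ⊢
    rw [map_mul]
    exact Submodule.mul_mem_mul hx hy

/-- `e(α I) = e(α) e(I)` for a unit `α`. [folklore] -/
theorem map_ringEquiv_units_smul (e : D ≃+* D') (α : Dˣ) (I : Submodule ℤ D) :
    (α • I).map (e.toAddEquiv.toIntLinearEquiv : D →ₗ[ℤ] D') =
      Units.map (e : D →* D') α • I.map (e.toAddEquiv.toIntLinearEquiv : D →ₗ[ℤ] D') := by
  ext x
  rw [mem_map_ringEquiv_iff, mem_units_smul_submodule_iff, mem_units_smul_submodule_iff,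
    mem_map_ringEquiv_iff, Units.smul_def, Units.smul_def, smul_eq_mul, smul_eq_mul, map_mul,
    ← map_inv, Units.coe_map, MonoidHom.coe_coe, RingEquiv.symm_apply_apply]

/-- `e(e⁻¹(α)) = α` on units. [folklore] -/
theorem unitsMap_ringEquiv_symm_apply (e : D ≃+* D') (α : D'ˣ) :
    Units.map (e : D →* D') (Units.map (e.symm : D' →* D) α) = α :=
  Units.ext (e.apply_symm_apply (α : D'))

/-- `e⁻¹(e(α)) = α` on units. [folklore] -/
theorem unitsMap_ringEquiv_apply_symm (e : D ≃+* D') (α : Dˣ) :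
    Units.map (e.symm : D' →* D) (Units.map (e : D →* D') α) = α :=
  Units.ext (e.symm_apply_apply (α : D))

/-- `[e(I) : e(J)] = [I : J]`. [folklore] -/
theorem relIndex_map_ringEquiv (e : D ≃+* D') (J I : Submodule ℤ D) :
    (J.map (e.toAddEquiv.toIntLinearEquiv : D →ₗ[ℤ] D')).toAddSubgroup.relIndex
        (I.map (e.toAddEquiv.toIntLinearEquiv : D →ₗ[ℤ] D')).toAddSubgroup =
      J.toAddSubgroup.relIndex I.toAddSubgroup := by
  rw [Submodule.map_toAddSubgroup, Submodule.map_toAddSubgroup]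
  exact AddSubgroup.relIndex_map_map_of_injective _ _ e.injective

/-- `e` carries full lattices to full lattices. [folklore] -/
theorem IsFullLattice.map_ringEquiv (e : D ≃+* D') {I : Submodule ℤ D} (hI : IsFullLattice D I) :
    IsFullLattice D' (I.map (e.toAddEquiv.toIntLinearEquiv : D →ₗ[ℤ] D')) := by
  refine ⟨hI.1.map _, fun d => ?_⟩
  obtain ⟨n, hn, hnd⟩ := hI.2 (e.symm d)
  refine ⟨n, hn, ?_⟩
  rw [mem_map_ringEquiv_iff, map_zsmul]
  exact hnd

namespace Brandt

/-! ### Orders and ideals -/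

/-- `O_L(e(I)) = e(O_L(I))`. [folklore] -/
theorem leftOrder_map_ringEquiv (e : D ≃+* D') (I : Submodule ℤ D) :
    leftOrder (I.map (e.toAddEquiv.toIntLinearEquiv : D →ₗ[ℤ] D')) =
      (leftOrder I).map (e.toAddEquiv.toIntLinearEquiv : D →ₗ[ℤ] D') := by
  ext x
  rw [mem_map_ringEquiv_iff, mem_leftOrder_iff, mem_leftOrder_iff]
  constructor
  · intro h m hm
    have := h (e m) ((apply_mem_map_ringEquiv_iff e).2 hm)
    rwa [mem_map_ringEquiv_iff, map_mul, RingEquiv.symm_apply_apply] at this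
  · intro h m hm
    rw [mem_map_ringEquiv_iff] at hm ⊢
    rw [map_mul]
    exact h _ hm

/-- `O_R(e(I)) = e(O_R(I))`. [folklore] -/
theorem rightOrder_map_ringEquiv (e : D ≃+* D') (I : Submodule ℤ D) :
    rightOrder (I.map (e.toAddEquiv.toIntLinearEquiv : D →ₗ[ℤ] D')) =
      (rightOrder I).map (e.toAddEquiv.toIntLinearEquiv : D →ₗ[ℤ] D') := by
  ext x
  rw [mem_map_ringEquiv_iff, mem_rightOrder_iff, mem_rightOrder_iff]
  constructor
  · intro h m hm
    have := h (e m) ((apply_mem_map_ringEquiv_iff e).2 hm)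
    rwa [mem_map_ringEquiv_iff, map_mul, RingEquiv.symm_apply_apply] at this
  · intro h m hm
    rw [mem_map_ringEquiv_iff] at hm ⊢
    rw [map_mul]
    exact h _ hm

/-- `e` carries orders to orders. [folklore] -/
theorem IsOrder.map_ringEquiv (e : D ≃+* D') {O : Submodule ℤ D} (hO : IsOrder D O) :
    IsOrder D' (O.map (e.toAddEquiv.toIntLinearEquiv : D →ₗ[ℤ] D')) where
  one_mem := by
    rw [mem_map_ringEquiv_iff, map_one]
    exact hO.one_mem
  mul_mem a ha b hb := by
    rw [mem_map_ringEquiv_iff] at ha hb ⊢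
    rw [map_mul]
    exact hO.mul_mem _ ha _ hb
  isFullLattice := hO.isFullLattice.map_ringEquiv e

/-- `e` carries maximal orders to maximal orders. [folklore] -/
theorem IsMaximalOrder.map_ringEquiv (e : D ≃+* D') {O : Submodule ℤ D} (hO : IsMaximalOrder D O) :
    IsMaximalOrder D' (O.map (e.toAddEquiv.toIntLinearEquiv : D →ₗ[ℤ] D')) := by
  refine ⟨hO.1.map_ringEquiv e, fun O' hO' hle => ?_⟩
  have h1 : O ≤ O'.map (e.symm.toAddEquiv.toIntLinearEquiv : D' →ₗ[ℤ] D) := by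
    rw [← map_ringEquiv_symm_map e O]
    exact Submodule.map_mono hle
  have h2 := hO.2 _ (hO'.map_ringEquiv e.symm) h1
  rw [← map_map_ringEquiv_symm e O', h2]

/-- `e(O)` is maximal iff `O` is. [folklore] -/
theorem isMaximalOrder_map_ringEquiv_iff (e : D ≃+* D') {O : Submodule ℤ D} :
    IsMaximalOrder D' (O.map (e.toAddEquiv.toIntLinearEquiv : D →ₗ[ℤ] D')) ↔ IsMaximalOrder D O := by
  refine ⟨fun h => ?_, fun h => h.map_ringEquiv e⟩
  have := h.map_ringEquiv e.symm
  rwa [map_ringEquiv_symm_map] at this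

/-- `e` carries Eichler orders of level `N` to Eichler orders of level `N`. [folklore] -/
theorem IsEichlerOrder.map_ringEquiv (e : D ≃+* D') {O : Submodule ℤ D} {N : ℕ}
    (hO : IsEichlerOrder D O N) :
    IsEichlerOrder D' (O.map (e.toAddEquiv.toIntLinearEquiv : D →ₗ[ℤ] D')) N := by
  obtain ⟨O₁, O₂, h₁, h₂, rfl, hidx⟩ := hO
  refine ⟨_, _, h₁.map_ringEquiv e, h₂.map_ringEquiv e, ?_, ?_⟩
  · exact Submodule.map_inf _ e.injective
  · rw [← hidx, ← relIndex_map_ringEquiv e (O₁ ⊓ O₂) O₁]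

/-- `e(O)` is an Eichler order of level `N` iff `O` is. [folklore] -/
theorem isEichlerOrder_map_ringEquiv_iff (e : D ≃+* D') {O : Submodule ℤ D} {N : ℕ} :
    IsEichlerOrder D' (O.map (e.toAddEquiv.toIntLinearEquiv : D →ₗ[ℤ] D')) N ↔
      IsEichlerOrder D O N := by
  refine ⟨fun h => ?_, fun h => h.map_ringEquiv e⟩
  have := h.map_ringEquiv e.symm
  rwa [map_ringEquiv_symm_map] at this

/-- The unit index `|Oˣ| / 2` is invariant: `unitIndex e(O) = unitIndex O`. [folklore] -/
theorem unitIndex_map_ringEquiv (e : D ≃+* D') (O : Submodule ℤ D) :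
    unitIndex (O.map (e.toAddEquiv.toIntLinearEquiv : D →ₗ[ℤ] D')) = unitIndex O := by
  unfold unitIndex
  congr 1
  refine (Nat.card_congr (Equiv.subtypeEquiv e.toEquiv fun x => ?_)).symm
  change _ ↔ e x ∈ _ ∧ ∃ y ∈ _, e x * y = 1 ∧ y * e x = 1
  rw [apply_mem_map_ringEquiv_iff]
  refine and_congr_right fun _ => ⟨?_, ?_⟩
  · rintro ⟨y, hy, h1, h2⟩
    refine ⟨e y, (apply_mem_map_ringEquiv_iff e).2 hy, ?_, ?_⟩
    · rw [← map_mul, h1, map_one]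
    · rw [← map_mul, h2, map_one]
  · rintro ⟨y, hy, h1, h2⟩
    refine ⟨e.symm y, (mem_map_ringEquiv_iff e).1 hy, e.injective ?_, e.injective ?_⟩
    · rw [map_mul, RingEquiv.apply_symm_apply, h1, map_one]
    · rw [map_mul, RingEquiv.apply_symm_apply, h2, map_one]

/-- `e` carries invertible lattices to invertible lattices. [folklore] -/
theorem IsInvertible.map_ringEquiv (e : D ≃+* D') {I : Submodule ℤ D} (hI : IsInvertible D I) :
    IsInvertible D' (I.map (e.toAddEquiv.toIntLinearEquiv : D →ₗ[ℤ] D')) := by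
  obtain ⟨I', hI', h1, h2, h3, h4⟩ := hI
  refine ⟨I'.map (e.toAddEquiv.toIntLinearEquiv : D →ₗ[ℤ] D'), hI'.map_ringEquiv e, ?_, ?_, ?_, ?_⟩
  · rw [← map_ringEquiv_mul, h1, leftOrder_map_ringEquiv]
  · rw [leftOrder_map_ringEquiv, rightOrder_map_ringEquiv, h2]
  · rw [← map_ringEquiv_mul, h3, rightOrder_map_ringEquiv]
  · rw [leftOrder_map_ringEquiv, rightOrder_map_ringEquiv, h4]

/-- `e` carries right `O`-ideals to right `e(O)`-ideals. [folklore] -/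
theorem map_ringEquiv_mem_rightIdeals (e : D ≃+* D') {O I : Submodule ℤ D} (hI : I ∈ rightIdeals O) :
    I.map (e.toAddEquiv.toIntLinearEquiv : D →ₗ[ℤ] D') ∈
      rightIdeals (O.map (e.toAddEquiv.toIntLinearEquiv : D →ₗ[ℤ] D')) :=
  ⟨hI.1.map_ringEquiv e, by rw [rightOrder_map_ringEquiv, hI.2.1], hI.2.2.map_ringEquiv e⟩

/-! ### The Brandt sets, the class set, weights and matrices -/

/-- The set counted by `T(n)` for `e(O)` on the representatives `e(I')`, `e(I)` is the image under
`J ↦ e(J)` of the set counted for `O` on `I'`, `I`. [folklore] -/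
theorem brandtSet_map_ringEquiv (e : D ≃+* D') (n : ℕ) (I' I : Submodule ℤ D) :
    {J : Submodule ℤ D' | J ≤ I.map (e.toAddEquiv.toIntLinearEquiv : D →ₗ[ℤ] D') ∧
        J.toAddSubgroup.relIndex (I.map (e.toAddEquiv.toIntLinearEquiv : D →ₗ[ℤ] D')).toAddSubgroup =
          n ^ 2 ∧
        ∃ α : D'ˣ, J = α • I'.map (e.toAddEquiv.toIntLinearEquiv : D →ₗ[ℤ] D')} =
      Submodule.map (e.toAddEquiv.toIntLinearEquiv : D →ₗ[ℤ] D') ''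
        {J : Submodule ℤ D | J ≤ I ∧ J.toAddSubgroup.relIndex I.toAddSubgroup = n ^ 2 ∧
          ∃ α : Dˣ, J = α • I'} := by
  ext J
  simp only [Set.mem_setOf_eq, Set.mem_image]
  constructor
  · rintro ⟨hle, hidx, α, rfl⟩
    refine ⟨Units.map (e.symm : D' →* D) α • I', ⟨?_, ?_, _, rfl⟩, ?_⟩
    · rwa [← map_ringEquiv_le_iff e, map_ringEquiv_units_smul, unitsMap_ringEquiv_symm_apply]
    · rwa [← relIndex_map_ringEquiv e, map_ringEquiv_units_smul, unitsMap_ringEquiv_symm_apply]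
    · rw [map_ringEquiv_units_smul, unitsMap_ringEquiv_symm_apply]
  · rintro ⟨J, ⟨hle, hidx, α, rfl⟩, rfl⟩
    exact ⟨Submodule.map_mono hle, by rw [relIndex_map_ringEquiv, hidx],
      Units.map (e : D →* D') α, map_ringEquiv_units_smul e α I'⟩

/-- The Brandt counts agree: `#(set for e(O) on e(I'), e(I)) = #(set for O on I', I)`. [folklore] -/
theorem ncard_brandtSet_map_ringEquiv (e : D ≃+* D') (n : ℕ) (I' I : Submodule ℤ D) :
    {J : Submodule ℤ D' | J ≤ I.map (e.toAddEquiv.toIntLinearEquiv : D →ₗ[ℤ] D') ∧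
        J.toAddSubgroup.relIndex (I.map (e.toAddEquiv.toIntLinearEquiv : D →ₗ[ℤ] D')).toAddSubgroup =
          n ^ 2 ∧
        ∃ α : D'ˣ, J = α • I'.map (e.toAddEquiv.toIntLinearEquiv : D →ₗ[ℤ] D')}.ncard =
      {J : Submodule ℤ D | J ≤ I ∧ J.toAddSubgroup.relIndex I.toAddSubgroup = n ^ 2 ∧
          ∃ α : Dˣ, J = α • I'}.ncard := by
  rw [brandtSet_map_ringEquiv, Set.ncard_image_of_injective _ (map_ringEquiv_injective e)]

/-- Two right ideals are in the same class iff their images under `e` are. [folklore] -/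
theorem rightClassSetoid_map_ringEquiv_iff (e : D ≃+* D') {O : Submodule ℤ D} (I J : rightIdeals O) :
    (rightClassSetoid (O.map (e.toAddEquiv.toIntLinearEquiv : D →ₗ[ℤ] D')))
        ⟨_, map_ringEquiv_mem_rightIdeals e I.2⟩ ⟨_, map_ringEquiv_mem_rightIdeals e J.2⟩ ↔
      (rightClassSetoid O) I J := by
  change (∃ α : D'ˣ, (J : Submodule ℤ D).map _ = α • (I : Submodule ℤ D).map _) ↔
    ∃ α : Dˣ, (J : Submodule ℤ D) = α • (I : Submodule ℤ D)
  constructor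
  · rintro ⟨α, hα⟩
    refine ⟨Units.map (e.symm : D' →* D) α, map_ringEquiv_injective e ?_⟩
    rw [hα, map_ringEquiv_units_smul, unitsMap_ringEquiv_symm_apply]
  · rintro ⟨α, hα⟩
    exact ⟨Units.map (e : D →* D') α, by rw [hα, map_ringEquiv_units_smul]⟩

/-- **The class sets, weights and Brandt matrices of `O` and `e(O)` correspond**: there is a
bijection `ε : Cls O ≃ Cls e(O)` with `ε [I] = [e(I)]`, `weight e(O) (ε c) = weight O c` and
`matrix e(O) n (ε c) (ε d) = matrix O n c d` (Voight §17.3, §41.1: all three are functorial in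
ring isomorphisms). [cite: Voight2021, (41.1.1) and 41.1.3] -/
theorem exists_classSetEquiv_map_ringEquiv (e : D ≃+* D') (O : Submodule ℤ D) :
    ∃ ε : ClassSet O ≃ ClassSet (O.map (e.toAddEquiv.toIntLinearEquiv : D →ₗ[ℤ] D')),
      (∀ I : rightIdeals O, ε (Quotient.mk (rightClassSetoid O) I) =
        Quotient.mk (rightClassSetoid _) ⟨_, map_ringEquiv_mem_rightIdeals e I.2⟩) ∧
      (∀ c, weight (O.map (e.toAddEquiv.toIntLinearEquiv : D →ₗ[ℤ] D')) (ε c) = weight O c) ∧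
      ∀ n c d, matrix (O.map (e.toAddEquiv.toIntLinearEquiv : D →ₗ[ℤ] D')) n (ε c) (ε d) =
        matrix O n c d := by
  -- the bijection on right ideals
  have hO : (O.map (e.toAddEquiv.toIntLinearEquiv : D →ₗ[ℤ] D')).map
      (e.symm.toAddEquiv.toIntLinearEquiv : D' →ₗ[ℤ] D) = O := map_ringEquiv_symm_map e O
  let ε₀ : rightIdeals O ≃ rightIdeals (O.map (e.toAddEquiv.toIntLinearEquiv : D →ₗ[ℤ] D')) :=
    { toFun := fun I => ⟨_, map_ringEquiv_mem_rightIdeals e I.2⟩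
      invFun := fun I' =>
        ⟨(I' : Submodule ℤ D').map (e.symm.toAddEquiv.toIntLinearEquiv : D' →ₗ[ℤ] D), by
          have h := map_ringEquiv_mem_rightIdeals e.symm I'.2
          rwa [hO] at h⟩
      left_inv := fun I => Subtype.ext (map_ringEquiv_symm_map e I.1)
      right_inv := fun I' => Subtype.ext (map_map_ringEquiv_symm e I'.1) }
  let ε : ClassSet O ≃ ClassSet (O.map (e.toAddEquiv.toIntLinearEquiv : D →ₗ[ℤ] D')) :=
    Quotient.congr ε₀ fun I J => (rightClassSetoid_map_ringEquiv_iff e I J).symm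
  have hε : ∀ I : rightIdeals O, ε (Quotient.mk (rightClassSetoid O) I) =
      Quotient.mk (rightClassSetoid _) ⟨_, map_ringEquiv_mem_rightIdeals e I.2⟩ :=
    fun I => Quotient.congr_mk _ _ _
  refine ⟨ε, hε, fun c => ?_, fun n c d => ?_⟩
  · induction c using Quotient.inductionOn with
    | h I =>
      rw [hε, weight_mk, weight_mk]
      change unitIndex (leftOrder ((I : Submodule ℤ D).map _)) = _
      rw [leftOrder_map_ringEquiv, unitIndex_map_ringEquiv]
  · induction c using Quotient.inductionOn with
    | h I' =>
      induction d using Quotient.inductionOn with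
      | h I =>
        rw [hε, hε, matrix_apply_eq_ncard, matrix_apply_eq_ncard]
        exact congrArg Nat.cast (ncard_brandtSet_map_ringEquiv e n I' I)

/-- The class set of `e(O)` is finite iff that of `O` is. [folklore] -/
theorem finite_classSet_map_ringEquiv_iff (e : D ≃+* D') (O : Submodule ℤ D) :
    Finite (ClassSet (O.map (e.toAddEquiv.toIntLinearEquiv : D →ₗ[ℤ] D'))) ↔ Finite (ClassSet O) := by
  obtain ⟨ε, -, -, -⟩ := exists_classSetEquiv_map_ringEquiv e O
  exact ⟨fun _ => Finite.of_equiv _ ε.symm, fun _ => Finite.of_equiv _ ε⟩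

/-- **`ξ` is invariant under ring isomorphisms**: `xiOfOrder e(O) N λ = xiOfOrder O N λ` (the
Brandt data correspond along `ε : Cls O ≃ Cls e(O)`, and `xi` is invariant under reindexing,
`xi_eigenLattice_reindex`). [cite: PollackWeston2011, §2.1] -/
theorem xiOfOrder_map_ringEquiv (e : D ≃+* D') (O : Submodule ℤ D) (N : ℕ) (lam : ℕ → ℤ) :
    xiOfOrder (O.map (e.toAddEquiv.toIntLinearEquiv : D →ₗ[ℤ] D')) N lam = xiOfOrder O N lam := by
  classical
  by_cases hfin : Finite (ClassSet O)
  · haveI : Finite (ClassSet (O.map (e.toAddEquiv.toIntLinearEquiv : D →ₗ[ℤ] D'))) :=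
      (finite_classSet_map_ringEquiv_iff e O).2 hfin
    letI : Fintype (ClassSet O) := Fintype.ofFinite _
    letI : Fintype (ClassSet (O.map (e.toAddEquiv.toIntLinearEquiv : D →ₗ[ℤ] D'))) :=
      Fintype.ofFinite _
    obtain ⟨ε, -, hw, hT⟩ := exists_classSetEquiv_map_ringEquiv e O
    have hmat : (matrix (O.map (e.toAddEquiv.toIntLinearEquiv : D →ₗ[ℤ] D'))) =
        fun n => Matrix.reindex ε ε (matrix O n) := by
      funext n
      ext a b
      rw [Matrix.reindex_apply, Matrix.submatrix_apply, ← hT n (ε.symm a) (ε.symm b),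
        Equiv.apply_symm_apply, Equiv.apply_symm_apply]
    have hwt : weight (O.map (e.toAddEquiv.toIntLinearEquiv : D →ₗ[ℤ] D')) = weight O ∘ ε.symm := by
      funext a
      rw [Function.comp_apply, ← hw (ε.symm a), Equiv.apply_symm_apply]
    rw [xiOfOrder_eq, xiOfOrder_eq, hmat, hwt, xi_eigenLattice_reindex]
  · have hfin' : ¬ Finite (ClassSet (O.map (e.toAddEquiv.toIntLinearEquiv : D →ₗ[ℤ] D'))) :=
      fun h => hfin ((finite_classSet_map_ringEquiv_iff e O).1 h)
    rw [xiOfOrder, dif_neg hfin', xiOfOrder, dif_neg hfin]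

/-! ### Brandt setups -/

variable {Nplus Nminus : ℕ}

/-- **Two Brandt setups of type `(N⁺, N⁻)` whose Eichler orders correspond under a ring
isomorphism of their quaternion algebras have the same `ξ`.** [cite: PollackWeston2011, §2.1] -/
theorem XiSetup.xi_eq_of_ringEquiv (S S' : XiSetup Nplus Nminus) (e : S.D ≃+* S'.D)
    (h : S'.O = S.O.map (e.toAddEquiv.toIntLinearEquiv : S.D →ₗ[ℤ] S'.D)) (lam : ℕ → ℤ) :
    S'.xi lam = S.xi lam := by
  rw [XiSetup.xi, XiSetup.xi, h, xiOfOrder_map_ringEquiv]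

end Brandt

end Literature.NumberTheory.Automorphic

end
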